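import Mathlib
import HarnessLib
import Summits.ValiantsHypothesis.ValiantsHypothesis.Theorems.LacunarySymmetroidMatrixDescartesOsculationLawCuspCubicNonMonicAlgebra
import Summits.ValiantsHypothesis.ValiantsHypothesis.Theorems.LacunarySymmetroidMatrixDescartesOsculationLawCuspCubicNonMonicReductionPoly
import Summits.ValiantsHypothesis.ValiantsHypothesis.Theorems.LacunarySymmetroidMatrixDescartesOsculationCensusRankOneLower

/-!
# ValiantsHypothesis / LacunarySymmetroid — crux `MatrixDescartes` (stmt-ValiantsHypothesis-18050, V1),
# line «osculation-law» (`Cruxes/MatrixDescartes/Lines/osculation_law.lean`), rung O3 «extremal-support families from the census»: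
# the RANK-THREE certificate at a GENERAL splitting `(3, s)` — non-monic cubic letter: finiteness + count from three exact checks (UPPER side; the LOWER side is the companion file `…RankThreeSLower`)

Roster R2664 (b) / R2685 (O3 = val-sym-engine-7; this file engine-7 g5).  Companion of ✓ `…OsculationCensusRankThreeTopCert` (g4, the monic top
splitting `(3,0)`), ✓ `…RankTwoSCert` (`(2,s)`), ✓ `…RankOneCert` (`(1,s)`).  Needed for the O3 table's `(3,1)` entries (F5 = the `ν(4,3) = 10`
extremiser at its four rank-three splittings; located-exact 0 / 1 / 2 / 2, OSC-TABLE-g3) which have no kernel counterpart so far.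

CONTENT (every `K`, every `s`; the line's `osculationSet d S` with `blockProj`, `insertionPoly`, `euler`, `logHessian` UNFOLDED verbatim).  The
insertion polynomial at `(3,s)` is a cubic `Ψ(t,b) = a₃(t)b³ + a₂(t)b² + a₁(t)b + a₀(t)` (`a₃ = det G₂₂`, `a₀ = det G`; hypothesis `hΦ`, discharged at
`s = 1` by ✓ `OsculationCensus.insertionPoly_three_one`); on the curve `a₃(t)⁶·H(t,b) = R₂(t)b² + R₁(t)b + R₀(t)` with the tree's pseudo-remainder
polynomials (✓ `OsculationRankThree.hess_pseudo_reduce_poly3`, texts of `hR2/hR1/hR0` VERBATIM), so `R₂b² + R₁b + R₀ = 0` at every osculation point; one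
Euclid step gives `L₁(t) b + L₀(t) = 0` (`L₁ = a₁R₂² − a₃R₀R₂ − a₂R₁R₂ + a₃R₁²`, `L₀ = a₀R₂² − a₂R₀R₂ + a₃R₀R₁`) and then `N(t) = 0`,
`N = R₂L₀² − R₁L₀L₁ + R₀L₁²` (plain `ring` identities, as in ✓ `OsculationCuspCubic.nonmonic_cubic_curve_ncard_le`).
* `osc_rankThreeS_finite_card_le` (UPPER): if `N ≢ 0`, `L₁ ≢ 0` and NO VERTICAL FIBRE (`a₃, a₂, a₁, a₀` have no common positive zero) the osculation set is
  FINITE with `ncard ≤ N_N + 3·N_L` (`deg N ≤ N_N`, `deg L₁ ≤ N_L`: an abscissa with `L₁ ≠ 0` is a root of `N` carrying ONE point `b = −L₀/L₁`, a root of `L₁`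
  carries at most the three roots of the non-zero cubic fibre).
* `osc_rankThreeS_card_ge` (LOWER): `k` pairwise separated windows `[l, u] ⊂ (0, ∞)` with `N(l)·N(u) ≤ 0` and `L₁·L₀ < 0`, `R₂ ≠ 0`, `a₃ ≠ 0` on `[l, u]`
  exhibit `k` distinct osculation points `(t, −L₀(t)/L₁(t))` (`R₂b²+R₁b+R₀ = N/L₁² = 0`; `Ψ = 0` by the Euclid identity and `R₂ ≠ 0`; `H = 0` by the
  reduction and `a₃ ≠ 0`), so `k ≤ ncard`.

HONEST FRAMING.  Calibration tooling for a line stub (`m = 4` is covered by `rungFour` / `rungAll`); the LAW `stub_osculationLaw`, the crux `MatrixDescartes`,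
Conjecture B and `VP ≠ VNP` are OPEN / NOT proved; no summit statement is proved by this file.  No definitions, no named facts; Mathlib + the tree files
`…CuspCubicNonMonicAlgebra` (`eval_Psi3`, `eval_logHessian_Psi3`), `…CuspCubicNonMonicReductionPoly` (`hess_pseudo_reduce_poly3`),
`…OsculationCensusRankOneLower` (`exists_root_of_mul_nonpos`).
-/

-- `Summit.ValiantsHypothesis.ValiantsHypothesis.…` is the tree's mandated single-conjunct layout (Sub = Summit).
set_option linter.dupNamespace false
-- the three reduction polynomials make the statements long left-nested sums: raise the elaborator's recursion budget.
set_option maxRecDepth 100000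

noncomputable section

namespace Summit.ValiantsHypothesis.ValiantsHypothesis.Theorems.LacunarySymmetroidMatrixDescartes

open Polynomial Matrix Finset
open scoped BigOperators

namespace OsculationCensus

/-- A real cubic with some non-zero coefficient is not the zero polynomial. [folklore] -/
theorem cubic_ne_zero_of {c₃ c₂ c₁ c₀ : ℝ} (h : c₃ ≠ 0 ∨ c₂ ≠ 0 ∨ c₁ ≠ 0 ∨ c₀ ≠ 0) :
    (C c₃ * X ^ 3 + C c₂ * X ^ 2 + C c₁ * X + C c₀ : ℝ[X]) ≠ 0 := by
  intro h0
  have e3 := congr_arg (fun q : ℝ[X] => q.coeff 3) h0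
  have e2 := congr_arg (fun q : ℝ[X] => q.coeff 2) h0
  have e1 := congr_arg (fun q : ℝ[X] => q.coeff 1) h0
  have e0 := congr_arg (fun q : ℝ[X] => q.coeff 0) h0
  simp only [coeff_add, coeff_C_mul, coeff_X_pow, coeff_X, coeff_C, coeff_zero] at e3 e2 e1 e0
  norm_num at e3 e2 e1 e0
  rcases h with h | h | h | h <;> contradiction

-- the statement carries the three reduction polynomials and the osculation set three times.
set_option maxHeartbeats 1600000 in
/-- **Rank-three certificate, splitting `(3, s)` (UPPER side).**  See the module docstring. [folklore] -/
theorem osc_rankThreeS_finite_card_le {K s : ℕ} (d : Fin K → ℕ) (S : Fin K → Matrix (Fin 3 ⊕ Fin s) (Fin 3 ⊕ Fin s) ℝ)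
    (a₃ a₂ a₁ a₀ R₂ R₁ R₀ L₁ L₀ : ℝ[X])
    (hΦ : (∑ l, (MvPolynomial.X (0 : Fin 2) : MvPolynomial (Fin 2) ℝ) ^ d l •
              (S l).map (MvPolynomial.C : ℝ →+* MvPolynomial (Fin 2) ℝ)
            + (MvPolynomial.X (1 : Fin 2) : MvPolynomial (Fin 2) ℝ) •
              (Matrix.fromBlocks 1 0 0 0 : Matrix (Fin 3 ⊕ Fin s) (Fin 3 ⊕ Fin s) ℝ).map
                (MvPolynomial.C : ℝ →+* MvPolynomial (Fin 2) ℝ)).det =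
      (MvPolynomial.X 1 * MvPolynomial.X 1 * MvPolynomial.X 1 * Polynomial.aeval (MvPolynomial.X 0 : MvPolynomial (Fin 2) ℝ) a₃ + MvPolynomial.X 1 * MvPolynomial.X 1 * Polynomial.aeval (MvPolynomial.X 0 : MvPolynomial (Fin 2) ℝ) a₂ + MvPolynomial.X 1 * Polynomial.aeval (MvPolynomial.X 0 : MvPolynomial (Fin 2) ℝ) a₁ + Polynomial.aeval (MvPolynomial.X 0 : MvPolynomial (Fin 2) ℝ) a₀))
    (hR2 : R₂ = (6 : ℝ[X]) * a₃ ^ (6 : ℕ) * a₂ * a₀ * (X * derivative (X * derivative a₀)) - (5 : ℝ[X]) * a₃ ^ (6 : ℕ) * a₂ * (X * derivative a₀) ^ (2 : ℕ) + (4 : ℝ[X]) * a₃ ^ (6 : ℕ) * a₁ ^ (2 :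
          ℕ) * (X * derivative (X * derivative a₀)) + (12 : ℝ[X]) * a₃ ^ (6 : ℕ) * a₁ * a₀ * (X * derivative (X * derivative a₁)) - (12 : ℝ[X]) * a₃ ^ (6 : ℕ) * a₁ * (X * derivative a₁) * (X
          * derivative a₀) + (9 : ℝ[X]) * a₃ ^ (6 : ℕ) * a₀ ^ (2 : ℕ) * (X * derivative (X * derivative a₂)) - (6 : ℝ[X]) * a₃ ^ (6 : ℕ) * a₀ * (X * derivative a₂) * (X * derivative a₀) - (3
          : ℝ[X]) * a₃ ^ (6 : ℕ) * a₀ * (X * derivative a₁) ^ (2 : ℕ) - (5 : ℝ[X]) * a₃ ^ (5 : ℕ) * a₂ ^ (2 : ℕ) * a₁ * (X * derivative (X * derivative a₀)) - (7 : ℝ[X]) * a₃ ^ (5 : ℕ) * a₂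
          ^ (2 : ℕ) * a₀ * (X * derivative (X * derivative a₁)) + (8 : ℝ[X]) * a₃ ^ (5 : ℕ) * a₂ ^ (2 : ℕ) * (X * derivative a₁) * (X * derivative a₀) - (8 : ℝ[X]) * a₃ ^ (5 : ℕ) * a₂ * a₁ ^
          (2 : ℕ) * (X * derivative (X * derivative a₁)) - (22 : ℝ[X]) * a₃ ^ (5 : ℕ) * a₂ * a₁ * a₀ * (X * derivative (X * derivative a₂)) + (14 : ℝ[X]) * a₃ ^ (5 : ℕ) * a₂ * a₁ * (X *
          derivative a₂) * (X * derivative a₀) + (7 : ℝ[X]) * a₃ ^ (5 : ℕ) * a₂ * a₁ * (X * derivative a₁) ^ (2 : ℕ) - (15 : ℝ[X]) * a₃ ^ (5 : ℕ) * a₂ * a₀ ^ (2 : ℕ) * (X * derivative (X *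
          derivative a₃)) + (4 : ℝ[X]) * a₃ ^ (5 : ℕ) * a₂ * a₀ * (X * derivative a₃) * (X * derivative a₀) + (4 : ℝ[X]) * a₃ ^ (5 : ℕ) * a₂ * a₀ * (X * derivative a₂) * (X * derivative a₁)
          - (4 : ℝ[X]) * a₃ ^ (5 : ℕ) * a₁ ^ (3 : ℕ) * (X * derivative (X * derivative a₂)) - (16 : ℝ[X]) * a₃ ^ (5 : ℕ) * a₁ ^ (2 : ℕ) * a₀ * (X * derivative (X * derivative a₃)) + (4 :
          ℝ[X]) * a₃ ^ (5 : ℕ) * a₁ ^ (2 : ℕ) * (X * derivative a₃) * (X * derivative a₀) + (4 : ℝ[X]) * a₃ ^ (5 : ℕ) * a₁ ^ (2 : ℕ) * (X * derivative a₂) * (X * derivative a₁) - (6 : ℝ[X])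
          * a₃ ^ (5 : ℕ) * a₁ * a₀ * (X * derivative a₃) * (X * derivative a₁) - (3 : ℝ[X]) * a₃ ^ (5 : ℕ) * a₁ * a₀ * (X * derivative a₂) ^ (2 : ℕ) - (12 : ℝ[X]) * a₃ ^ (5 : ℕ) * a₀ ^ (2 :
          ℕ) * (X * derivative a₃) * (X * derivative a₂) + a₃ ^ (4 : ℕ) * a₂ ^ (4 : ℕ) * (X * derivative (X * derivative a₀)) + (6 : ℝ[X]) * a₃ ^ (4 : ℕ) * a₂ ^ (3 : ℕ) * a₁ * (X *
          derivative (X * derivative a₁)) + (8 : ℝ[X]) * a₃ ^ (4 : ℕ) * a₂ ^ (3 : ℕ) * a₀ * (X * derivative (X * derivative a₂)) - (6 : ℝ[X]) * a₃ ^ (4 : ℕ) * a₂ ^ (3 : ℕ) * (X * derivative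
          a₂) * (X * derivative a₀) - (3 : ℝ[X]) * a₃ ^ (4 : ℕ) * a₂ ^ (3 : ℕ) * (X * derivative a₁) ^ (2 : ℕ) + (13 : ℝ[X]) * a₃ ^ (4 : ℕ) * a₂ ^ (2 : ℕ) * a₁ ^ (2 : ℕ) * (X * derivative (X
          * derivative a₂)) + (34 : ℝ[X]) * a₃ ^ (4 : ℕ) * a₂ ^ (2 : ℕ) * a₁ * a₀ * (X * derivative (X * derivative a₃)) - (12 : ℝ[X]) * a₃ ^ (4 : ℕ) * a₂ ^ (2 : ℕ) * a₁ * (X * derivative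
          a₃) * (X * derivative a₀) - (12 : ℝ[X]) * a₃ ^ (4 : ℕ) * a₂ ^ (2 : ℕ) * a₁ * (X * derivative a₂) * (X * derivative a₁) + (2 : ℝ[X]) * a₃ ^ (4 : ℕ) * a₂ ^ (2 : ℕ) * a₀ * (X *
          derivative a₃) * (X * derivative a₁) + a₃ ^ (4 : ℕ) * a₂ ^ (2 : ℕ) * a₀ * (X * derivative a₂) ^ (2 : ℕ) + (12 : ℝ[X]) * a₃ ^ (4 : ℕ) * a₂ * a₁ ^ (3 : ℕ) * (X * derivative (X *
          derivative a₃)) - (2 : ℝ[X]) * a₃ ^ (4 : ℕ) * a₂ * a₁ ^ (2 : ℕ) * (X * derivative a₃) * (X * derivative a₁) - a₃ ^ (4 : ℕ) * a₂ * a₁ ^ (2 : ℕ) * (X * derivative a₂) ^ (2 : ℕ) + (32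
          : ℝ[X]) * a₃ ^ (4 : ℕ) * a₂ * a₁ * a₀ * (X * derivative a₃) * (X * derivative a₂) + (19 : ℝ[X]) * a₃ ^ (4 : ℕ) * a₂ * a₀ ^ (2 : ℕ) * (X * derivative a₃) ^ (2 : ℕ) + (4 : ℝ[X]) * a₃
          ^ (4 : ℕ) * a₁ ^ (3 : ℕ) * (X * derivative a₃) * (X * derivative a₂) + (17 : ℝ[X]) * a₃ ^ (4 : ℕ) * a₁ ^ (2 : ℕ) * a₀ * (X * derivative a₃) ^ (2 : ℕ) - a₃ ^ (3 : ℕ) * a₂ ^ (5 : ℕ)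
          * (X * derivative (X * derivative a₁)) - (7 : ℝ[X]) * a₃ ^ (3 : ℕ) * a₂ ^ (4 : ℕ) * a₁ * (X * derivative (X * derivative a₂)) - (9 : ℝ[X]) * a₃ ^ (3 : ℕ) * a₂ ^ (4 : ℕ) * a₀ * (X *
          derivative (X * derivative a₃)) + (4 : ℝ[X]) * a₃ ^ (3 : ℕ) * a₂ ^ (4 : ℕ) * (X * derivative a₃) * (X * derivative a₀) + (4 : ℝ[X]) * a₃ ^ (3 : ℕ) * a₂ ^ (4 : ℕ) * (X * derivative
          a₂) * (X * derivative a₁) - (19 : ℝ[X]) * a₃ ^ (3 : ℕ) * a₂ ^ (3 : ℕ) * a₁ ^ (2 : ℕ) * (X * derivative (X * derivative a₃)) + (6 : ℝ[X]) * a₃ ^ (3 : ℕ) * a₂ ^ (3 : ℕ) * a₁ * (X *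
          derivative a₃) * (X * derivative a₁) + (3 : ℝ[X]) * a₃ ^ (3 : ℕ) * a₂ ^ (3 : ℕ) * a₁ * (X * derivative a₂) ^ (2 : ℕ) - (12 : ℝ[X]) * a₃ ^ (3 : ℕ) * a₂ ^ (3 : ℕ) * a₀ * (X *
          derivative a₃) * (X * derivative a₂) - (12 : ℝ[X]) * a₃ ^ (3 : ℕ) * a₂ ^ (2 : ℕ) * a₁ ^ (2 : ℕ) * (X * derivative a₃) * (X * derivative a₂) - (45 : ℝ[X]) * a₃ ^ (3 : ℕ) * a₂ ^ (2 :
          ℕ) * a₁ * a₀ * (X * derivative a₃) ^ (2 : ℕ) - (13 : ℝ[X]) * a₃ ^ (3 : ℕ) * a₂ * a₁ ^ (3 : ℕ) * (X * derivative a₃) ^ (2 : ℕ) + a₃ ^ (2 : ℕ) * a₂ ^ (6 : ℕ) * (X * derivative (X *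
          derivative a₂)) + (8 : ℝ[X]) * a₃ ^ (2 : ℕ) * a₂ ^ (5 : ℕ) * a₁ * (X * derivative (X * derivative a₃)) - (2 : ℝ[X]) * a₃ ^ (2 : ℕ) * a₂ ^ (5 : ℕ) * (X * derivative a₃) * (X *
          derivative a₁) - a₃ ^ (2 : ℕ) * a₂ ^ (5 : ℕ) * (X * derivative a₂) ^ (2 : ℕ) + (4 : ℝ[X]) * a₃ ^ (2 : ℕ) * a₂ ^ (4 : ℕ) * a₁ * (X * derivative a₃) * (X * derivative a₂) + (13 :
          ℝ[X]) * a₃ ^ (2 : ℕ) * a₂ ^ (4 : ℕ) * a₀ * (X * derivative a₃) ^ (2 : ℕ) + (22 : ℝ[X]) * a₃ ^ (2 : ℕ) * a₂ ^ (3 : ℕ) * a₁ ^ (2 : ℕ) * (X * derivative a₃) ^ (2 : ℕ) - a₃ * a₂ ^ (7 :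
          ℕ) * (X * derivative (X * derivative a₃)) - (9 : ℝ[X]) * a₃ * a₂ ^ (5 : ℕ) * a₁ * (X * derivative a₃) ^ (2 : ℕ) + a₂ ^ (7 : ℕ) * (X * derivative a₃) ^ (2 : ℕ))
    (hR1 : R₁ = (12 : ℝ[X]) * a₃ ^ (6 : ℕ) * a₁ * a₀ * (X * derivative (X * derivative a₀)) - (8 : ℝ[X]) * a₃ ^ (6 : ℕ) * a₁ * (X * derivative a₀) ^ (2 : ℕ) + (9 : ℝ[X]) * a₃ ^ (6 : ℕ) * a₀ ^ (2 :
          ℕ) * (X * derivative (X * derivative a₁)) - (12 : ℝ[X]) * a₃ ^ (6 : ℕ) * a₀ * (X * derivative a₁) * (X * derivative a₀) - a₃ ^ (5 : ℕ) * a₂ ^ (2 : ℕ) * a₀ * (X * derivative (X *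
          derivative a₀)) - (4 : ℝ[X]) * a₃ ^ (5 : ℕ) * a₂ * a₁ ^ (2 : ℕ) * (X * derivative (X * derivative a₀)) - (10 : ℝ[X]) * a₃ ^ (5 : ℕ) * a₂ * a₁ * a₀ * (X * derivative (X * derivative
          a₁)) + (8 : ℝ[X]) * a₃ ^ (5 : ℕ) * a₂ * a₁ * (X * derivative a₁) * (X * derivative a₀) - (6 : ℝ[X]) * a₃ ^ (5 : ℕ) * a₂ * a₀ ^ (2 : ℕ) * (X * derivative (X * derivative a₂)) + (6 :
          ℝ[X]) * a₃ ^ (5 : ℕ) * a₂ * a₀ * (X * derivative a₂) * (X * derivative a₀) + (3 : ℝ[X]) * a₃ ^ (5 : ℕ) * a₂ * a₀ * (X * derivative a₁) ^ (2 : ℕ) - (4 : ℝ[X]) * a₃ ^ (5 : ℕ) * a₁ ^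
          (3 : ℕ) * (X * derivative (X * derivative a₁)) - (16 : ℝ[X]) * a₃ ^ (5 : ℕ) * a₁ ^ (2 : ℕ) * a₀ * (X * derivative (X * derivative a₂)) + (8 : ℝ[X]) * a₃ ^ (5 : ℕ) * a₁ ^ (2 : ℕ) *
          (X * derivative a₂) * (X * derivative a₀) + (4 : ℝ[X]) * a₃ ^ (5 : ℕ) * a₁ ^ (2 : ℕ) * (X * derivative a₁) ^ (2 : ℕ) - (21 : ℝ[X]) * a₃ ^ (5 : ℕ) * a₁ * a₀ ^ (2 : ℕ) * (X *
          derivative (X * derivative a₃)) + (4 : ℝ[X]) * a₃ ^ (5 : ℕ) * a₁ * a₀ * (X * derivative a₃) * (X * derivative a₀) + (4 : ℝ[X]) * a₃ ^ (5 : ℕ) * a₁ * a₀ * (X * derivative a₂) * (X *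
          derivative a₁) - (6 : ℝ[X]) * a₃ ^ (5 : ℕ) * a₀ ^ (2 : ℕ) * (X * derivative a₃) * (X * derivative a₁) - (3 : ℝ[X]) * a₃ ^ (5 : ℕ) * a₀ ^ (2 : ℕ) * (X * derivative a₂) ^ (2 : ℕ) +
          a₃ ^ (4 : ℕ) * a₂ ^ (3 : ℕ) * a₁ * (X * derivative (X * derivative a₀)) + a₃ ^ (4 : ℕ) * a₂ ^ (3 : ℕ) * a₀ * (X * derivative (X * derivative a₁)) + (5 : ℝ[X]) * a₃ ^ (4 : ℕ) * a₂ ^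
          (2 : ℕ) * a₁ ^ (2 : ℕ) * (X * derivative (X * derivative a₁)) + (12 : ℝ[X]) * a₃ ^ (4 : ℕ) * a₂ ^ (2 : ℕ) * a₁ * a₀ * (X * derivative (X * derivative a₂)) - (6 : ℝ[X]) * a₃ ^ (4 :
          ℕ) * a₂ ^ (2 : ℕ) * a₁ * (X * derivative a₂) * (X * derivative a₀) - (3 : ℝ[X]) * a₃ ^ (4 : ℕ) * a₂ ^ (2 : ℕ) * a₁ * (X * derivative a₁) ^ (2 : ℕ) + (7 : ℝ[X]) * a₃ ^ (4 : ℕ) * a₂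
          ^ (2 : ℕ) * a₀ ^ (2 : ℕ) * (X * derivative (X * derivative a₃)) - (4 : ℝ[X]) * a₃ ^ (4 : ℕ) * a₂ ^ (2 : ℕ) * a₀ * (X * derivative a₃) * (X * derivative a₀) - (4 : ℝ[X]) * a₃ ^ (4 :
          ℕ) * a₂ ^ (2 : ℕ) * a₀ * (X * derivative a₂) * (X * derivative a₁) + (8 : ℝ[X]) * a₃ ^ (4 : ℕ) * a₂ * a₁ ^ (3 : ℕ) * (X * derivative (X * derivative a₂)) + (30 : ℝ[X]) * a₃ ^ (4 :
          ℕ) * a₂ * a₁ ^ (2 : ℕ) * a₀ * (X * derivative (X * derivative a₃)) - (8 : ℝ[X]) * a₃ ^ (4 : ℕ) * a₂ * a₁ ^ (2 : ℕ) * (X * derivative a₃) * (X * derivative a₀) - (8 : ℝ[X]) * a₃ ^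
          (4 : ℕ) * a₂ * a₁ ^ (2 : ℕ) * (X * derivative a₂) * (X * derivative a₁) + (2 : ℝ[X]) * a₃ ^ (4 : ℕ) * a₂ * a₁ * a₀ * (X * derivative a₃) * (X * derivative a₁) + a₃ ^ (4 : ℕ) * a₂ *
          a₁ * a₀ * (X * derivative a₂) ^ (2 : ℕ) + (12 : ℝ[X]) * a₃ ^ (4 : ℕ) * a₂ * a₀ ^ (2 : ℕ) * (X * derivative a₃) * (X * derivative a₂) + (4 : ℝ[X]) * a₃ ^ (4 : ℕ) * a₁ ^ (4 : ℕ) * (X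
          * derivative (X * derivative a₃)) + (20 : ℝ[X]) * a₃ ^ (4 : ℕ) * a₁ ^ (2 : ℕ) * a₀ * (X * derivative a₃) * (X * derivative a₂) + (22 : ℝ[X]) * a₃ ^ (4 : ℕ) * a₁ * a₀ ^ (2 : ℕ) * (X
          * derivative a₃) ^ (2 : ℕ) - a₃ ^ (3 : ℕ) * a₂ ^ (4 : ℕ) * a₁ * (X * derivative (X * derivative a₁)) - a₃ ^ (3 : ℕ) * a₂ ^ (4 : ℕ) * a₀ * (X * derivative (X * derivative a₂)) - (6
          : ℝ[X]) * a₃ ^ (3 : ℕ) * a₂ ^ (3 : ℕ) * a₁ ^ (2 : ℕ) * (X * derivative (X * derivative a₂)) - (14 : ℝ[X]) * a₃ ^ (3 : ℕ) * a₂ ^ (3 : ℕ) * a₁ * a₀ * (X * derivative (X * derivative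
          a₃)) + (4 : ℝ[X]) * a₃ ^ (3 : ℕ) * a₂ ^ (3 : ℕ) * a₁ * (X * derivative a₃) * (X * derivative a₀) + (4 : ℝ[X]) * a₃ ^ (3 : ℕ) * a₂ ^ (3 : ℕ) * a₁ * (X * derivative a₂) * (X *
          derivative a₁) + (2 : ℝ[X]) * a₃ ^ (3 : ℕ) * a₂ ^ (3 : ℕ) * a₀ * (X * derivative a₃) * (X * derivative a₁) + a₃ ^ (3 : ℕ) * a₂ ^ (3 : ℕ) * a₀ * (X * derivative a₂) ^ (2 : ℕ) - (13
          : ℝ[X]) * a₃ ^ (3 : ℕ) * a₂ ^ (2 : ℕ) * a₁ ^ (3 : ℕ) * (X * derivative (X * derivative a₃)) + (4 : ℝ[X]) * a₃ ^ (3 : ℕ) * a₂ ^ (2 : ℕ) * a₁ ^ (2 : ℕ) * (X * derivative a₃) * (X *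
          derivative a₁) + (2 : ℝ[X]) * a₃ ^ (3 : ℕ) * a₂ ^ (2 : ℕ) * a₁ ^ (2 : ℕ) * (X * derivative a₂) ^ (2 : ℕ) - (16 : ℝ[X]) * a₃ ^ (3 : ℕ) * a₂ ^ (2 : ℕ) * a₁ * a₀ * (X * derivative a₃)
          * (X * derivative a₂) - (11 : ℝ[X]) * a₃ ^ (3 : ℕ) * a₂ ^ (2 : ℕ) * a₀ ^ (2 : ℕ) * (X * derivative a₃) ^ (2 : ℕ) - (8 : ℝ[X]) * a₃ ^ (3 : ℕ) * a₂ * a₁ ^ (3 : ℕ) * (X * derivative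
          a₃) * (X * derivative a₂) - (37 : ℝ[X]) * a₃ ^ (3 : ℕ) * a₂ * a₁ ^ (2 : ℕ) * a₀ * (X * derivative a₃) ^ (2 : ℕ) - (4 : ℝ[X]) * a₃ ^ (3 : ℕ) * a₁ ^ (4 : ℕ) * (X * derivative a₃) ^
          (2 : ℕ) + a₃ ^ (2 : ℕ) * a₂ ^ (5 : ℕ) * a₁ * (X * derivative (X * derivative a₂)) + a₃ ^ (2 : ℕ) * a₂ ^ (5 : ℕ) * a₀ * (X * derivative (X * derivative a₃)) + (7 : ℝ[X]) * a₃ ^ (2 :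
          ℕ) * a₂ ^ (4 : ℕ) * a₁ ^ (2 : ℕ) * (X * derivative (X * derivative a₃)) - (2 : ℝ[X]) * a₃ ^ (2 : ℕ) * a₂ ^ (4 : ℕ) * a₁ * (X * derivative a₃) * (X * derivative a₁) - a₃ ^ (2 : ℕ) *
          a₂ ^ (4 : ℕ) * a₁ * (X * derivative a₂) ^ (2 : ℕ) + (4 : ℝ[X]) * a₃ ^ (2 : ℕ) * a₂ ^ (3 : ℕ) * a₁ ^ (2 : ℕ) * (X * derivative a₃) * (X * derivative a₂) + (19 : ℝ[X]) * a₃ ^ (2 : ℕ)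
          * a₂ ^ (3 : ℕ) * a₁ * a₀ * (X * derivative a₃) ^ (2 : ℕ) + (15 : ℝ[X]) * a₃ ^ (2 : ℕ) * a₂ ^ (2 : ℕ) * a₁ ^ (3 : ℕ) * (X * derivative a₃) ^ (2 : ℕ) - a₃ * a₂ ^ (6 : ℕ) * a₁ * (X *
          derivative (X * derivative a₃)) - a₃ * a₂ ^ (5 : ℕ) * a₀ * (X * derivative a₃) ^ (2 : ℕ) - (8 : ℝ[X]) * a₃ * a₂ ^ (4 : ℕ) * a₁ ^ (2 : ℕ) * (X * derivative a₃) ^ (2 : ℕ) + a₂ ^ (6 :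
          ℕ) * a₁ * (X * derivative a₃) ^ (2 : ℕ))
    (hR0 : R₀ = (9 : ℝ[X]) * a₃ ^ (6 : ℕ) * a₀ ^ (2 : ℕ) * (X * derivative (X * derivative a₀)) - (9 : ℝ[X]) * a₃ ^ (6 : ℕ) * a₀ * (X * derivative a₀) ^ (2 : ℕ) - (4 : ℝ[X]) * a₃ ^ (5 : ℕ) * a₂ *
          a₁ * a₀ * (X * derivative (X * derivative a₀)) - (6 : ℝ[X]) * a₃ ^ (5 : ℕ) * a₂ * a₀ ^ (2 : ℕ) * (X * derivative (X * derivative a₁)) + (8 : ℝ[X]) * a₃ ^ (5 : ℕ) * a₂ * a₀ * (X *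
          derivative a₁) * (X * derivative a₀) - (4 : ℝ[X]) * a₃ ^ (5 : ℕ) * a₁ ^ (2 : ℕ) * a₀ * (X * derivative (X * derivative a₁)) - (12 : ℝ[X]) * a₃ ^ (5 : ℕ) * a₁ * a₀ ^ (2 : ℕ) * (X *
          derivative (X * derivative a₂)) + (8 : ℝ[X]) * a₃ ^ (5 : ℕ) * a₁ * a₀ * (X * derivative a₂) * (X * derivative a₀) + (4 : ℝ[X]) * a₃ ^ (5 : ℕ) * a₁ * a₀ * (X * derivative a₁) ^ (2 :
          ℕ) - (9 : ℝ[X]) * a₃ ^ (5 : ℕ) * a₀ ^ (3 : ℕ) * (X * derivative (X * derivative a₃)) + a₃ ^ (4 : ℕ) * a₂ ^ (3 : ℕ) * a₀ * (X * derivative (X * derivative a₀)) + (5 : ℝ[X]) * a₃ ^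
          (4 : ℕ) * a₂ ^ (2 : ℕ) * a₁ * a₀ * (X * derivative (X * derivative a₁)) + (7 : ℝ[X]) * a₃ ^ (4 : ℕ) * a₂ ^ (2 : ℕ) * a₀ ^ (2 : ℕ) * (X * derivative (X * derivative a₂)) - (6 :
          ℝ[X]) * a₃ ^ (4 : ℕ) * a₂ ^ (2 : ℕ) * a₀ * (X * derivative a₂) * (X * derivative a₀) - (3 : ℝ[X]) * a₃ ^ (4 : ℕ) * a₂ ^ (2 : ℕ) * a₀ * (X * derivative a₁) ^ (2 : ℕ) + (8 : ℝ[X]) *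
          a₃ ^ (4 : ℕ) * a₂ * a₁ ^ (2 : ℕ) * a₀ * (X * derivative (X * derivative a₂)) + (22 : ℝ[X]) * a₃ ^ (4 : ℕ) * a₂ * a₁ * a₀ ^ (2 : ℕ) * (X * derivative (X * derivative a₃)) - (8 :
          ℝ[X]) * a₃ ^ (4 : ℕ) * a₂ * a₁ * a₀ * (X * derivative a₃) * (X * derivative a₀) - (8 : ℝ[X]) * a₃ ^ (4 : ℕ) * a₂ * a₁ * a₀ * (X * derivative a₂) * (X * derivative a₁) + (4 : ℝ[X])
          * a₃ ^ (4 : ℕ) * a₂ * a₀ ^ (2 : ℕ) * (X * derivative a₃) * (X * derivative a₁) + (2 : ℝ[X]) * a₃ ^ (4 : ℕ) * a₂ * a₀ ^ (2 : ℕ) * (X * derivative a₂) ^ (2 : ℕ) + (4 : ℝ[X]) * a₃ ^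
          (4 : ℕ) * a₁ ^ (3 : ℕ) * a₀ * (X * derivative (X * derivative a₃)) + (16 : ℝ[X]) * a₃ ^ (4 : ℕ) * a₁ * a₀ ^ (2 : ℕ) * (X * derivative a₃) * (X * derivative a₂) + (9 : ℝ[X]) * a₃ ^
          (4 : ℕ) * a₀ ^ (3 : ℕ) * (X * derivative a₃) ^ (2 : ℕ) - a₃ ^ (3 : ℕ) * a₂ ^ (4 : ℕ) * a₀ * (X * derivative (X * derivative a₁)) - (6 : ℝ[X]) * a₃ ^ (3 : ℕ) * a₂ ^ (3 : ℕ) * a₁ *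
          a₀ * (X * derivative (X * derivative a₂)) - (8 : ℝ[X]) * a₃ ^ (3 : ℕ) * a₂ ^ (3 : ℕ) * a₀ ^ (2 : ℕ) * (X * derivative (X * derivative a₃)) + (4 : ℝ[X]) * a₃ ^ (3 : ℕ) * a₂ ^ (3 :
          ℕ) * a₀ * (X * derivative a₃) * (X * derivative a₀) + (4 : ℝ[X]) * a₃ ^ (3 : ℕ) * a₂ ^ (3 : ℕ) * a₀ * (X * derivative a₂) * (X * derivative a₁) - (13 : ℝ[X]) * a₃ ^ (3 : ℕ) * a₂ ^
          (2 : ℕ) * a₁ ^ (2 : ℕ) * a₀ * (X * derivative (X * derivative a₃)) + (4 : ℝ[X]) * a₃ ^ (3 : ℕ) * a₂ ^ (2 : ℕ) * a₁ * a₀ * (X * derivative a₃) * (X * derivative a₁) + (2 : ℝ[X]) *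
          a₃ ^ (3 : ℕ) * a₂ ^ (2 : ℕ) * a₁ * a₀ * (X * derivative a₂) ^ (2 : ℕ) - (12 : ℝ[X]) * a₃ ^ (3 : ℕ) * a₂ ^ (2 : ℕ) * a₀ ^ (2 : ℕ) * (X * derivative a₃) * (X * derivative a₂) - (8 :
          ℝ[X]) * a₃ ^ (3 : ℕ) * a₂ * a₁ ^ (2 : ℕ) * a₀ * (X * derivative a₃) * (X * derivative a₂) - (28 : ℝ[X]) * a₃ ^ (3 : ℕ) * a₂ * a₁ * a₀ ^ (2 : ℕ) * (X * derivative a₃) ^ (2 : ℕ) - (4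
          : ℝ[X]) * a₃ ^ (3 : ℕ) * a₁ ^ (3 : ℕ) * a₀ * (X * derivative a₃) ^ (2 : ℕ) + a₃ ^ (2 : ℕ) * a₂ ^ (5 : ℕ) * a₀ * (X * derivative (X * derivative a₂)) + (7 : ℝ[X]) * a₃ ^ (2 : ℕ) *
          a₂ ^ (4 : ℕ) * a₁ * a₀ * (X * derivative (X * derivative a₃)) - (2 : ℝ[X]) * a₃ ^ (2 : ℕ) * a₂ ^ (4 : ℕ) * a₀ * (X * derivative a₃) * (X * derivative a₁) - a₃ ^ (2 : ℕ) * a₂ ^ (4 :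
          ℕ) * a₀ * (X * derivative a₂) ^ (2 : ℕ) + (4 : ℝ[X]) * a₃ ^ (2 : ℕ) * a₂ ^ (3 : ℕ) * a₁ * a₀ * (X * derivative a₃) * (X * derivative a₂) + (12 : ℝ[X]) * a₃ ^ (2 : ℕ) * a₂ ^ (3 : ℕ)
          * a₀ ^ (2 : ℕ) * (X * derivative a₃) ^ (2 : ℕ) + (15 : ℝ[X]) * a₃ ^ (2 : ℕ) * a₂ ^ (2 : ℕ) * a₁ ^ (2 : ℕ) * a₀ * (X * derivative a₃) ^ (2 : ℕ) - a₃ * a₂ ^ (6 : ℕ) * a₀ * (X *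
          derivative (X * derivative a₃)) - (8 : ℝ[X]) * a₃ * a₂ ^ (4 : ℕ) * a₁ * a₀ * (X * derivative a₃) ^ (2 : ℕ) + a₂ ^ (6 : ℕ) * a₀ * (X * derivative a₃) ^ (2 : ℕ))
    (hL1 : L₁ = (a₁ * R₂ ^ 2 - a₃ * R₀ * R₂ - a₂ * R₁ * R₂ + a₃ * R₁ ^ 2)) (hL0 : L₀ = (a₀ * R₂ ^ 2 - a₂ * R₀ * R₂ + a₃ * R₀ * R₁))
    (hN : (R₂ * L₀ ^ 2 - R₁ * L₀ * L₁ + R₀ * L₁ ^ 2) ≠ 0) (hL : L₁ ≠ 0)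
    (hnv : ∀ t : ℝ, 0 < t → a₃.eval t ≠ 0 ∨ a₂.eval t ≠ 0 ∨ a₁.eval t ≠ 0 ∨ a₀.eval t ≠ 0)
    (NN NL : ℕ) (hNN : (R₂ * L₀ ^ 2 - R₁ * L₀ * L₁ + R₀ * L₁ ^ 2).natDegree ≤ NN) (hNL : L₁.natDegree ≤ NL) :
    {p : Fin 2 → ℝ | 0 < p 0 ∧ 0 < p 1 ∧ MvPolynomial.eval p (∑ l, (MvPolynomial.X (0 : Fin 2) : MvPolynomial (Fin 2) ℝ) ^ d l • (S l).map (MvPolynomial.C : ℝ →+* MvPolynomial (Fin 2) ℝ) +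
      (MvPolynomial.X (1 : Fin 2) : MvPolynomial (Fin 2) ℝ) • (Matrix.fromBlocks 1 0 0 0 : Matrix (Fin 3 ⊕ Fin s) (Fin 3 ⊕ Fin s) ℝ).map (MvPolynomial.C : ℝ →+* MvPolynomial (Fin 2) ℝ)).det = 0 ∧
      MvPolynomial.eval p (MvPolynomial.X 0 * MvPolynomial.pderiv 0 (MvPolynomial.X 0 * MvPolynomial.pderiv 0 (∑ l, (MvPolynomial.X (0 : Fin 2) : MvPolynomial (Fin 2) ℝ) ^ d l • (S l).map
      (MvPolynomial.C : ℝ →+* MvPolynomial (Fin 2) ℝ) + (MvPolynomial.X (1 : Fin 2) : MvPolynomial (Fin 2) ℝ) • (Matrix.fromBlocks 1 0 0 0 : Matrix (Fin 3 ⊕ Fin s) (Fin 3 ⊕ Fin s) ℝ).map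
      (MvPolynomial.C : ℝ →+* MvPolynomial (Fin 2) ℝ)).det) * (MvPolynomial.X 1 * MvPolynomial.pderiv 1 (∑ l, (MvPolynomial.X (0 : Fin 2) : MvPolynomial (Fin 2) ℝ) ^ d l • (S l).map
      (MvPolynomial.C : ℝ →+* MvPolynomial (Fin 2) ℝ) + (MvPolynomial.X (1 : Fin 2) : MvPolynomial (Fin 2) ℝ) • (Matrix.fromBlocks 1 0 0 0 : Matrix (Fin 3 ⊕ Fin s) (Fin 3 ⊕ Fin s) ℝ).map
      (MvPolynomial.C : ℝ →+* MvPolynomial (Fin 2) ℝ)).det) ^ 2 - 2 * (MvPolynomial.X 0 * MvPolynomial.pderiv 0 (MvPolynomial.X 1 * MvPolynomial.pderiv 1 (∑ l, (MvPolynomial.X (0 : Fin 2) :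
      MvPolynomial (Fin 2) ℝ) ^ d l • (S l).map (MvPolynomial.C : ℝ →+* MvPolynomial (Fin 2) ℝ) + (MvPolynomial.X (1 : Fin 2) : MvPolynomial (Fin 2) ℝ) • (Matrix.fromBlocks 1 0 0 0 : Matrix (Fin 3
      ⊕ Fin s) (Fin 3 ⊕ Fin s) ℝ).map (MvPolynomial.C : ℝ →+* MvPolynomial (Fin 2) ℝ)).det)) * (MvPolynomial.X 0 * MvPolynomial.pderiv 0 (∑ l, (MvPolynomial.X (0 : Fin 2) : MvPolynomial (Fin 2) ℝ)
      ^ d l • (S l).map (MvPolynomial.C : ℝ →+* MvPolynomial (Fin 2) ℝ) + (MvPolynomial.X (1 : Fin 2) : MvPolynomial (Fin 2) ℝ) • (Matrix.fromBlocks 1 0 0 0 : Matrix (Fin 3 ⊕ Fin s) (Fin 3 ⊕ Fin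
      s) ℝ).map (MvPolynomial.C : ℝ →+* MvPolynomial (Fin 2) ℝ)).det) * (MvPolynomial.X 1 * MvPolynomial.pderiv 1 (∑ l, (MvPolynomial.X (0 : Fin 2) : MvPolynomial (Fin 2) ℝ) ^ d l • (S l).map
      (MvPolynomial.C : ℝ →+* MvPolynomial (Fin 2) ℝ) + (MvPolynomial.X (1 : Fin 2) : MvPolynomial (Fin 2) ℝ) • (Matrix.fromBlocks 1 0 0 0 : Matrix (Fin 3 ⊕ Fin s) (Fin 3 ⊕ Fin s) ℝ).map
      (MvPolynomial.C : ℝ →+* MvPolynomial (Fin 2) ℝ)).det) + MvPolynomial.X 1 * MvPolynomial.pderiv 1 (MvPolynomial.X 1 * MvPolynomial.pderiv 1 (∑ l, (MvPolynomial.X (0 : Fin 2) : MvPolynomial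
      (Fin 2) ℝ) ^ d l • (S l).map (MvPolynomial.C : ℝ →+* MvPolynomial (Fin 2) ℝ) + (MvPolynomial.X (1 : Fin 2) : MvPolynomial (Fin 2) ℝ) • (Matrix.fromBlocks 1 0 0 0 : Matrix (Fin 3 ⊕ Fin s)
      (Fin 3 ⊕ Fin s) ℝ).map (MvPolynomial.C : ℝ →+* MvPolynomial (Fin 2) ℝ)).det) * (MvPolynomial.X 0 * MvPolynomial.pderiv 0 (∑ l, (MvPolynomial.X (0 : Fin 2) : MvPolynomial (Fin 2) ℝ) ^ d l •
      (S l).map (MvPolynomial.C : ℝ →+* MvPolynomial (Fin 2) ℝ) + (MvPolynomial.X (1 : Fin 2) : MvPolynomial (Fin 2) ℝ) • (Matrix.fromBlocks 1 0 0 0 : Matrix (Fin 3 ⊕ Fin s) (Fin 3 ⊕ Fin s) ℝ).map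
      (MvPolynomial.C : ℝ →+* MvPolynomial (Fin 2) ℝ)).det) ^ 2) = 0}.Finite ∧
    {p : Fin 2 → ℝ | 0 < p 0 ∧ 0 < p 1 ∧ MvPolynomial.eval p (∑ l, (MvPolynomial.X (0 : Fin 2) : MvPolynomial (Fin 2) ℝ) ^ d l • (S l).map (MvPolynomial.C : ℝ →+* MvPolynomial (Fin 2) ℝ) +
      (MvPolynomial.X (1 : Fin 2) : MvPolynomial (Fin 2) ℝ) • (Matrix.fromBlocks 1 0 0 0 : Matrix (Fin 3 ⊕ Fin s) (Fin 3 ⊕ Fin s) ℝ).map (MvPolynomial.C : ℝ →+* MvPolynomial (Fin 2) ℝ)).det = 0 ∧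
      MvPolynomial.eval p (MvPolynomial.X 0 * MvPolynomial.pderiv 0 (MvPolynomial.X 0 * MvPolynomial.pderiv 0 (∑ l, (MvPolynomial.X (0 : Fin 2) : MvPolynomial (Fin 2) ℝ) ^ d l • (S l).map
      (MvPolynomial.C : ℝ →+* MvPolynomial (Fin 2) ℝ) + (MvPolynomial.X (1 : Fin 2) : MvPolynomial (Fin 2) ℝ) • (Matrix.fromBlocks 1 0 0 0 : Matrix (Fin 3 ⊕ Fin s) (Fin 3 ⊕ Fin s) ℝ).map
      (MvPolynomial.C : ℝ →+* MvPolynomial (Fin 2) ℝ)).det) * (MvPolynomial.X 1 * MvPolynomial.pderiv 1 (∑ l, (MvPolynomial.X (0 : Fin 2) : MvPolynomial (Fin 2) ℝ) ^ d l • (S l).map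
      (MvPolynomial.C : ℝ →+* MvPolynomial (Fin 2) ℝ) + (MvPolynomial.X (1 : Fin 2) : MvPolynomial (Fin 2) ℝ) • (Matrix.fromBlocks 1 0 0 0 : Matrix (Fin 3 ⊕ Fin s) (Fin 3 ⊕ Fin s) ℝ).map
      (MvPolynomial.C : ℝ →+* MvPolynomial (Fin 2) ℝ)).det) ^ 2 - 2 * (MvPolynomial.X 0 * MvPolynomial.pderiv 0 (MvPolynomial.X 1 * MvPolynomial.pderiv 1 (∑ l, (MvPolynomial.X (0 : Fin 2) :
      MvPolynomial (Fin 2) ℝ) ^ d l • (S l).map (MvPolynomial.C : ℝ →+* MvPolynomial (Fin 2) ℝ) + (MvPolynomial.X (1 : Fin 2) : MvPolynomial (Fin 2) ℝ) • (Matrix.fromBlocks 1 0 0 0 : Matrix (Fin 3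
      ⊕ Fin s) (Fin 3 ⊕ Fin s) ℝ).map (MvPolynomial.C : ℝ →+* MvPolynomial (Fin 2) ℝ)).det)) * (MvPolynomial.X 0 * MvPolynomial.pderiv 0 (∑ l, (MvPolynomial.X (0 : Fin 2) : MvPolynomial (Fin 2) ℝ)
      ^ d l • (S l).map (MvPolynomial.C : ℝ →+* MvPolynomial (Fin 2) ℝ) + (MvPolynomial.X (1 : Fin 2) : MvPolynomial (Fin 2) ℝ) • (Matrix.fromBlocks 1 0 0 0 : Matrix (Fin 3 ⊕ Fin s) (Fin 3 ⊕ Fin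
      s) ℝ).map (MvPolynomial.C : ℝ →+* MvPolynomial (Fin 2) ℝ)).det) * (MvPolynomial.X 1 * MvPolynomial.pderiv 1 (∑ l, (MvPolynomial.X (0 : Fin 2) : MvPolynomial (Fin 2) ℝ) ^ d l • (S l).map
      (MvPolynomial.C : ℝ →+* MvPolynomial (Fin 2) ℝ) + (MvPolynomial.X (1 : Fin 2) : MvPolynomial (Fin 2) ℝ) • (Matrix.fromBlocks 1 0 0 0 : Matrix (Fin 3 ⊕ Fin s) (Fin 3 ⊕ Fin s) ℝ).map
      (MvPolynomial.C : ℝ →+* MvPolynomial (Fin 2) ℝ)).det) + MvPolynomial.X 1 * MvPolynomial.pderiv 1 (MvPolynomial.X 1 * MvPolynomial.pderiv 1 (∑ l, (MvPolynomial.X (0 : Fin 2) : MvPolynomial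
      (Fin 2) ℝ) ^ d l • (S l).map (MvPolynomial.C : ℝ →+* MvPolynomial (Fin 2) ℝ) + (MvPolynomial.X (1 : Fin 2) : MvPolynomial (Fin 2) ℝ) • (Matrix.fromBlocks 1 0 0 0 : Matrix (Fin 3 ⊕ Fin s)
      (Fin 3 ⊕ Fin s) ℝ).map (MvPolynomial.C : ℝ →+* MvPolynomial (Fin 2) ℝ)).det) * (MvPolynomial.X 0 * MvPolynomial.pderiv 0 (∑ l, (MvPolynomial.X (0 : Fin 2) : MvPolynomial (Fin 2) ℝ) ^ d l •
      (S l).map (MvPolynomial.C : ℝ →+* MvPolynomial (Fin 2) ℝ) + (MvPolynomial.X (1 : Fin 2) : MvPolynomial (Fin 2) ℝ) • (Matrix.fromBlocks 1 0 0 0 : Matrix (Fin 3 ⊕ Fin s) (Fin 3 ⊕ Fin s) ℝ).map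
      (MvPolynomial.C : ℝ →+* MvPolynomial (Fin 2) ℝ)).det) ^ 2) = 0}.ncard ≤ NN + 3 * NL := by
  classical
  rw [hΦ]
  set Φ : MvPolynomial (Fin 2) ℝ := (MvPolynomial.X 1 * MvPolynomial.X 1 * MvPolynomial.X 1 * Polynomial.aeval (MvPolynomial.X 0 : MvPolynomial (Fin 2) ℝ) a₃ + MvPolynomial.X 1 * MvPolynomial.X 1 * Polynomial.aeval (MvPolynomial.X 0 : MvPolynomial (Fin 2) ℝ) a₂ + MvPolynomial.X 1 * Polynomial.aeval (MvPolynomial.X 0 : MvPolynomial (Fin 2) ℝ) a₁ + Polynomial.aeval (MvPolynomial.X 0 : MvPolynomial (Fin 2) ℝ) a₀) with hΦdef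
  set N : ℝ[X] := (R₂ * L₀ ^ 2 - R₁ * L₀ * L₁ + R₀ * L₁ ^ 2) with hNdef
  set osc := {p : Fin 2 → ℝ | 0 < p 0 ∧ 0 < p 1 ∧ MvPolynomial.eval p Φ = 0 ∧
      MvPolynomial.eval p
        (MvPolynomial.X 0 * MvPolynomial.pderiv 0 (MvPolynomial.X 0 * MvPolynomial.pderiv 0 Φ)
            * (MvPolynomial.X 1 * MvPolynomial.pderiv 1 Φ) ^ 2
          - 2 * (MvPolynomial.X 0 * MvPolynomial.pderiv 0 (MvPolynomial.X 1 * MvPolynomial.pderiv 1 Φ))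
            * (MvPolynomial.X 0 * MvPolynomial.pderiv 0 Φ) * (MvPolynomial.X 1 * MvPolynomial.pderiv 1 Φ)
          + MvPolynomial.X 1 * MvPolynomial.pderiv 1 (MvPolynomial.X 1 * MvPolynomial.pderiv 1 Φ)
            * (MvPolynomial.X 0 * MvPolynomial.pderiv 0 Φ) ^ 2) = 0} with hosc
  -- (1) from the set: positivity, the cubic, the quadratic, `L₁(t) b + L₀(t) = 0`, `N(t) = 0`
  have from_osc : ∀ p ∈ osc, 0 < p 0 ∧ 0 < p 1 ∧
      a₃.eval (p 0) * p 1 ^ 3 + a₂.eval (p 0) * p 1 ^ 2 + a₁.eval (p 0) * p 1 + a₀.eval (p 0) = 0 ∧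
      L₁.eval (p 0) * p 1 + L₀.eval (p 0) = 0 ∧ N.eval (p 0) = 0 := by
    intro p hp
    obtain ⟨h0, hp1, hΦ0, hH0⟩ := hp
    rw [hΦdef, OsculationCuspCubic.eval_Psi3] at hΦ0
    rw [OsculationCuspCubic.eval_logHessian_Psi3 a₃ a₂ a₁ a₀ Φ hΦdef p] at hH0
    have hred := OsculationRankThree.hess_pseudo_reduce_poly3 a₃ a₂ a₁ a₀ (p 0) (p 1) hΦ0
    rw [hH0, mul_zero, ← hR2, ← hR1, ← hR0] at hred
    have hQ : R₂.eval (p 0) * p 1 ^ 2 + R₁.eval (p 0) * p 1 + R₀.eval (p 0) = 0 := hred.symm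
    -- Euclid: `R₂² Ψ = (a₃R₂ b + (a₂R₂ − a₃R₁))·Q + (L₁ b + L₀)`
    have hE : R₂.eval (p 0) ^ 2 * (a₃.eval (p 0) * p 1 ^ 3 + a₂.eval (p 0) * p 1 ^ 2 + a₁.eval (p 0) * p 1 + a₀.eval (p 0)) =
        (a₃.eval (p 0) * R₂.eval (p 0) * p 1 + (a₂.eval (p 0) * R₂.eval (p 0) - a₃.eval (p 0) * R₁.eval (p 0)))
            * (R₂.eval (p 0) * p 1 ^ 2 + R₁.eval (p 0) * p 1 + R₀.eval (p 0))
          + (L₁.eval (p 0) * p 1 + L₀.eval (p 0)) := by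
      rw [hL1, hL0]
      simp only [eval_add, eval_sub, eval_mul, eval_pow]
      ring
    have hlo : L₁.eval (p 0) * p 1 + L₀.eval (p 0) = 0 := by
      rw [hΦ0, hQ, mul_zero, mul_zero, zero_add] at hE
      exact hE.symm
    -- `N = L₁² · Q` once `L₀ = −L₁ b`
    have hNq : N.eval (p 0) = L₁.eval (p 0) ^ 2 * (R₂.eval (p 0) * p 1 ^ 2 + R₁.eval (p 0) * p 1 + R₀.eval (p 0)) := by
      have h0' : L₀.eval (p 0) = -(L₁.eval (p 0) * p 1) := by linarith
      rw [hNdef]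
      simp only [eval_add, eval_sub, eval_mul, eval_pow]
      rw [h0']
      ring
    refine ⟨h0, hp1, hΦ0, hlo, ?_⟩
    rw [hNq, hQ, mul_zero]
  -- (2) a finite cover: one point over each root of `N` off `L₁ = 0`, the cubic fibre over each root of `L₁`
  set FN : Finset (Fin 2 → ℝ) := N.roots.toFinset.image (fun t => (![t, -L₀.eval t / L₁.eval t] : Fin 2 → ℝ)) with hFN
  set FL : Finset (Fin 2 → ℝ) := L₁.roots.toFinset.biUnion (fun t =>
    ((C (a₃.eval t) * X ^ 3 + C (a₂.eval t) * X ^ 2 + C (a₁.eval t) * X + C (a₀.eval t) : ℝ[X]).roots.toFinset).image (fun b => (![t, b] : Fin 2 → ℝ))) with hFL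
  have hsub : osc ⊆ ↑(FN ∪ FL) := by
    intro p hp
    obtain ⟨ht, hb, hΨ0, hl, hn⟩ := from_osc p hp
    rw [Finset.coe_union, Set.mem_union, Finset.mem_coe, Finset.mem_coe]
    by_cases hLt : L₁.eval (p 0) = 0
    · right
      rw [hFL, Finset.mem_biUnion]
      refine ⟨p 0, ?_, ?_⟩
      · rw [Multiset.mem_toFinset]
        exact (mem_roots hL).2 hLt
      · rw [Finset.mem_image]
        refine ⟨p 1, ?_, ?_⟩
        · rw [Multiset.mem_toFinset, mem_roots (cubic_ne_zero_of (hnv (p 0) ht)), IsRoot.def]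
          simp only [eval_add, eval_mul, eval_pow, eval_C, eval_X]
          linear_combination hΨ0
        · funext i
          fin_cases i
          · rfl
          · rfl
    · left
      rw [hFN, Finset.mem_image]
      refine ⟨p 0, ?_, ?_⟩
      · rw [Multiset.mem_toFinset]
        exact (mem_roots hN).2 hn
      · have hb1 : -L₀.eval (p 0) / L₁.eval (p 0) = p 1 := by
          field_simp
          linarith
        funext i
        fin_cases i
        · rfl
        · exact hb1
  have hfin : osc.Finite := (Finset.finite_toSet (FN ∪ FL)).subset hsub
  refine ⟨hfin, ?_⟩
  have hFNc : FN.card ≤ NN := by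
    rw [hFN]
    exact Finset.card_image_le.trans ((Multiset.toFinset_card_le _).trans ((card_roots' N).trans hNN))
  have hFLc : FL.card ≤ 3 * NL := by
    rw [hFL]
    calc (L₁.roots.toFinset.biUnion (fun t => ((C (a₃.eval t) * X ^ 3 + C (a₂.eval t) * X ^ 2 + C (a₁.eval t) * X + C (a₀.eval t) : ℝ[X]).roots.toFinset).image (fun b => (![t, b] : Fin 2 → ℝ)))).card
        ≤ ∑ t ∈ L₁.roots.toFinset, (((C (a₃.eval t) * X ^ 3 + C (a₂.eval t) * X ^ 2 + C (a₁.eval t) * X + C (a₀.eval t) : ℝ[X]).roots.toFinset).image (fun b => (![t, b] : Fin 2 → ℝ))).card := Finset.card_biUnion_le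
      _ ≤ ∑ _t ∈ L₁.roots.toFinset, 3 := by
          refine Finset.sum_le_sum fun t _ => ?_
          refine Finset.card_image_le.trans ((Multiset.toFinset_card_le _).trans ?_)
          exact (card_roots' _).trans natDegree_cubic_le
      _ = L₁.roots.toFinset.card * 3 := by rw [Finset.sum_const, smul_eq_mul]
      _ ≤ NL * 3 := Nat.mul_le_mul_right _ ((Multiset.toFinset_card_le _).trans ((card_roots' L₁).trans hNL))
      _ = 3 * NL := Nat.mul_comm _ _
  calc osc.ncard ≤ (↑(FN ∪ FL) : Set (Fin 2 → ℝ)).ncard := Set.ncard_le_ncard hsub (Finset.finite_toSet _)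
    _ = (FN ∪ FL).card := Set.ncard_coe_finset _
    _ ≤ FN.card + FL.card := Finset.card_union_le _ _
    _ ≤ NN + 3 * NL := Nat.add_le_add hFNc hFLc

end OsculationCensus

end Summit.ValiantsHypothesis.ValiantsHypothesis.Theorems.LacunarySymmetroidMatrixDescartes
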